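import Mathlib
import HarnessLib
import Summits.HubbardSuperconductivity.HubbardSuperconductivity.Theorems.KLProgrammeKLRegimeEnginePairLadderRelativeReframe
import Summits.HubbardSuperconductivity.HubbardSuperconductivity.Theorems.KLProgrammeKLRegimeEnginePairTransferMemberFlow
import Summits.HubbardSuperconductivity.HubbardSuperconductivity.Theorems.KLProgrammeKLRegimeEngineV8PairTransferRelBarIdx

/-!
# Route `KLProgramme` — ENGINE child gen 8 (stmt-HubbardSuperconductivity-20437 `KLRegimeEngineV17F2`), skeleton v2 class #5 «(S)-transfer» rev 3 (RELATIVE family,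
# INDEX form of record, Export5 `PairTransferRelFamilyK5` / (X).3 `PairTransferStep5`): the KEYED per-pair step and the INDEX-family step —
# `pairTransferRelAt_succ_keyed`, `pairTransferRelIdx_family_succ` (cell gate-hubbard-kl, seat hubbard-kl-k3c1-p1 g11, technique «composed-map remainder propagation»)

WHY.  `pairTransferRelAt_succ` (p586440) is the class-#5 producer door with an ABSTRACT bundle (curves, inverse, majorants).  With the member flow typed BY NAME
(`…EnginePairTransferMemberFlow`: the curves `Aᵢ, Ȧᵢ, bᵢ, ḃᵢ, a` of the two members along slice `n+1` at the flowing frame `K_{n+1}` and all their calculus) and the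
re-frame door (`…EnginePairLadderRelativeReframe`: the start relation from the HISTORY clause at frame `K_n` across any perturbation, residue ∝ the pair's own
smallness), the bundle the (c) closer still owes per pair class is SIZES ONLY.  This file fixes that contract:

* **`pairTransferRelAt_succ_keyed`** — members `ψ₁, ψ₂` at `(K_{n+1}, n+1)`, history members `χ₁, χ₂` at `(K_n, n)` with clause `PairTransferRelAt … n Tb₀ χ₁ χ₂`,
  `Z^{K_{n+1}} ≠ 0` on the slice; the nine curve families `A₁ A₁′ A₂ A₂′ b₁ b₁′ b₂ b₂′ a` are ARGUMENTS pinned to the model by nine equations (pass `rfl`); per pair class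
  `Qm` the caller's `∃`-bundle is: a priori `|Aᵢ| ≤ m`, rates `Σ‖ḃᵢ‖ ≤ β′`, profiles `ρᵢ`, `m·β′, m·Σρᵢ ≤ 1/3`, the Riccati-defect sups `‖Ȧᵢ + Aᵢ·diag ḃᵢ·Aᵢ‖ ≤ ξᵢ`, the
  history arrays' size, the (F)(i) START RE-FRAME majorants `η_rel, η₁, η₂, d` of `(A₁(0), A₂(0), a(0))` against `(klMemberArrayF n ψᵢʰ, −(t_n[χ₁] − t_n[χ₂]))`,
  `m·Σ‖a(0)‖ ≤ 1/3`, the explicit re-framed start majorant `T₀ → R₀ → δ`, the RELATIVE source sup `ξ` and slice integral `I`, the four-term majorants `S, T`,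
  `m·Σ‖a(1)‖ ≤ 1/3`, and ONE budget line `T + Σ_c T(k,c)‖a(1)_c‖(3m/2) ≤ Tb Qm k k′` on the bare ball ⟹ `PairTransferRelAt … (n+1) Tb ψ₁ ψ₂`.
  (By `klmf_memberArray_flowData`/`klmf_relWeight_data`: `Aᵢ Qm 0` = ball array of `klCovSmearedPairAmplitude … (K_{n+1}) n (softCovOf (K_{n+1}) (ψᵢ + s^{K_{n+1}}_{n,n+1}))`
  and `a Qm 0 = −(t^{K_{n+1}}_n[ψ₁ + s] − t^{K_{n+1}}_n[ψ₂ + s])` — the history pair READ AT THE NEW FRAME; the (F)(i) lane bounds their distance to the frame-`K_n` objects.)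
* **`pairTransferRelIdx_family_succ`** — the INDEX form of record: members `s^{K}_{·,m}` (`softSymbolCompl`), ONE family of member curves indexed by the member index
  `m`, history = the family at `n` with bars `transferBarRelIdx … n m′` (`∀ m m′, n ≤ m′ ≤ m ≤ n_β+1`), conclusion = the family at `n+1` with bars `transferBarRelIdx … (n+1) m′`
  (`∀ m m′, n+1 ≤ m′ ≤ m ≤ n_β+1`) — i.e. literally `PairTransferRelFamilyK5 … n → PairTransferRelFamilyK5 … (n+1)` once Export5 lands (its body is this `∀ m m′` clause);
  the budget line is then discharged against `transferBarRelIdx_succ_room` (p590284) by the closer (`pairTransferRelIdx_budget_of_room` names the target).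
Plumbing over landed doors only; nothing about the model's sizes is asserted; nothing asserts superconductivity.  0 kit.
-/

noncomputable section

namespace Summit.HubbardSuperconductivity.HubbardSuperconductivity.Theorems.KLRegimeSplit

set_option linter.dupNamespace false -- summit = problem name (single-conjunct summit), D-0017

open Finset Matrix Set Literature.MathematicalPhysics.QuantumLattice Literature.Probability.LatticeModels GrassmannAlgebra
open Summit.HubbardSuperconductivity.HubbardSuperconductivity.Theorems.KLProgrammeCooperResummation
open Summit.HubbardSuperconductivity.HubbardSuperconductivity.Theorems.KLProgrammeLegKernels
open Summit.HubbardSuperconductivity.HubbardSuperconductivity.Theorems.DispersionFlow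
open Summit.HubbardSuperconductivity.HubbardSuperconductivity.Theorems.KLRegimeWick

/-! ## §1 The keyed per-pair step -/

section Keyed

variable (L M : ℕ) [NeZero L] [NeZero M]

set_option maxHeartbeats 1600000 in -- very long hypothesis bundle; the proof is plumbing into `pairTransferRelAt_succ`
/-- **`pairTransferRelAt_succ_keyed`** — the class-#5 rev-3 producer step at scale `n+1`, pair `(ψ₁ | ψ₂)`, with the member flow and the start re-frame BY NAME; the caller's
bundle is sizes only (see the module docstring). -/
theorem pairTransferRelAt_succ_keyed {β U μ : ℝ} {n : ℕ} {m : ℝ} (hm : 0 ≤ m) {ψ₁ ψ₂ χ₁ χ₂ : FreqMomentum L M → ℝ}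
    {Tb Tb₀ : TorusSite 2 L → TorusSite 2 L → TorusSite 2 L → ℝ}
    (hhist : PairTransferRelAt L M β U μ n Tb₀ χ₁ χ₂)
    (hZ : ∀ Λ ∈ Icc (klScale klE0 (n + 1)) (klScale klE0 n), hubbardEffPartitionFnCT L M β U μ 0 (klFlowFrameU L M β U μ (n + 1)) Λ ≠ 0)
    (A₁ A₁' A₂ A₂' : TorusSite 2 L → ℝ → Matrix (TorusSite 2 L) (TorusSite 2 L) ℂ) (b₁ b₁' b₂ b₂' : TorusSite 2 L → ℝ → TorusSite 2 L → ℂ)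
    (a : TorusSite 2 L → ℝ → TorusSite 2 L → ℂ)
    (hA₁def : A₁ = fun Qm t => Matrix.of fun k k' : TorusSite 2 L => if k ∈ klBall L μ 0 ∧ k' ∈ klBall L μ 0 then
      vertexFn L M β (gaussConv ℂ
        (softCovOf L M β μ (klFlowFrameU L M β U μ (n + 1)) ψ₁ + hubbardCovAboveCT L M β μ 0 (klFlowFrameU L M β U μ (n + 1)) (klScale klE0 (n + 1)) -
          hubbardCovAboveCT L M β μ 0 (klFlowFrameU L M β U μ (n + 1)) (klScale klE0 n + t * (klScale klE0 (n + 1) - klScale klE0 n)))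
        (hubbardEffectiveActionCT L M β U μ 0 (klFlowFrameU L M β U μ (n + 1)) (klScale klE0 n + t * (klScale klE0 (n + 1) - klScale klE0 n)))) 4
        ![(((omega0 M, k'), 0), 0), ((((omega0 M).rev, Qm - k'), 1), 0), ((((omega0 M).rev, Qm - k), 1), 1), (((omega0 M, k), 0), 1)]
      else 0)
    (hA₁'def : A₁' = fun Qm t => Matrix.of fun k k' : TorusSite 2 L => if k ∈ klBall L μ 0 ∧ k' ∈ klBall L μ 0 then
      (klScale klE0 (n + 1) - klScale klE0 n) • -((2 : ℂ)⁻¹ * vertexFn L M β (gaussConv ℂ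
        (softCovOf L M β μ (klFlowFrameU L M β U μ (n + 1)) ψ₁ + hubbardCovAboveCT L M β μ 0 (klFlowFrameU L M β U μ (n + 1)) (klScale klE0 (n + 1)) -
          hubbardCovAboveCT L M β μ 0 (klFlowFrameU L M β U μ (n + 1)) (klScale klE0 n + t * (klScale klE0 (n + 1) - klScale klE0 n)))
        (grassmannDerivPairing ℂ
          (Matrix.of fun X Y : HubbardFieldIdx L M => deriv (fun Λ'' : ℝ => hubbardCovAboveCT L M β μ 0 (klFlowFrameU L M β U μ (n + 1)) Λ'' X Y)
            (klScale klE0 n + t * (klScale klE0 (n + 1) - klScale klE0 n)))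
          (hubbardEffectiveActionCT L M β U μ 0 (klFlowFrameU L M β U μ (n + 1)) (klScale klE0 n + t * (klScale klE0 (n + 1) - klScale klE0 n)))
          (hubbardEffectiveActionCT L M β U μ 0 (klFlowFrameU L M β U μ (n + 1)) (klScale klE0 n + t * (klScale klE0 (n + 1) - klScale klE0 n))))) 4
        ![(((omega0 M, k'), 0), 0), ((((omega0 M).rev, Qm - k'), 1), 0), ((((omega0 M).rev, Qm - k), 1), 1), (((omega0 M, k), 0), 1)])
      else 0)
    (hA₂def : A₂ = fun Qm t => Matrix.of fun k k' : TorusSite 2 L => if k ∈ klBall L μ 0 ∧ k' ∈ klBall L μ 0 then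
      vertexFn L M β (gaussConv ℂ
        (softCovOf L M β μ (klFlowFrameU L M β U μ (n + 1)) ψ₂ + hubbardCovAboveCT L M β μ 0 (klFlowFrameU L M β U μ (n + 1)) (klScale klE0 (n + 1)) -
          hubbardCovAboveCT L M β μ 0 (klFlowFrameU L M β U μ (n + 1)) (klScale klE0 n + t * (klScale klE0 (n + 1) - klScale klE0 n)))
        (hubbardEffectiveActionCT L M β U μ 0 (klFlowFrameU L M β U μ (n + 1)) (klScale klE0 n + t * (klScale klE0 (n + 1) - klScale klE0 n)))) 4
        ![(((omega0 M, k'), 0), 0), ((((omega0 M).rev, Qm - k'), 1), 0), ((((omega0 M).rev, Qm - k), 1), 1), (((omega0 M, k), 0), 1)]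
      else 0)
    (hA₂'def : A₂' = fun Qm t => Matrix.of fun k k' : TorusSite 2 L => if k ∈ klBall L μ 0 ∧ k' ∈ klBall L μ 0 then
      (klScale klE0 (n + 1) - klScale klE0 n) • -((2 : ℂ)⁻¹ * vertexFn L M β (gaussConv ℂ
        (softCovOf L M β μ (klFlowFrameU L M β U μ (n + 1)) ψ₂ + hubbardCovAboveCT L M β μ 0 (klFlowFrameU L M β U μ (n + 1)) (klScale klE0 (n + 1)) -
          hubbardCovAboveCT L M β μ 0 (klFlowFrameU L M β U μ (n + 1)) (klScale klE0 n + t * (klScale klE0 (n + 1) - klScale klE0 n)))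
        (grassmannDerivPairing ℂ
          (Matrix.of fun X Y : HubbardFieldIdx L M => deriv (fun Λ'' : ℝ => hubbardCovAboveCT L M β μ 0 (klFlowFrameU L M β U μ (n + 1)) Λ'' X Y)
            (klScale klE0 n + t * (klScale klE0 (n + 1) - klScale klE0 n)))
          (hubbardEffectiveActionCT L M β U μ 0 (klFlowFrameU L M β U μ (n + 1)) (klScale klE0 n + t * (klScale klE0 (n + 1) - klScale klE0 n)))
          (hubbardEffectiveActionCT L M β U μ 0 (klFlowFrameU L M β U μ (n + 1)) (klScale klE0 n + t * (klScale klE0 (n + 1) - klScale klE0 n))))) 4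
        ![(((omega0 M, k'), 0), 0), ((((omega0 M).rev, Qm - k'), 1), 0), ((((omega0 M).rev, Qm - k), 1), 1), (((omega0 M, k), 0), 1)])
      else 0)
    (hb₁def : b₁ = fun Qm t p => -((klBubbleMass L M β μ (klFlowFrameU L M β U μ (n + 1))
        (fun k => ψ₁ k + (hubbardCutoffWeightCT L M β μ (klFlowFrameU L M β U μ (n + 1)) (klScale klE0 (n + 1)) k -
          hubbardCutoffWeightCT L M β μ (klFlowFrameU L M β U μ (n + 1)) (klScale klE0 n + t * (klScale klE0 (n + 1) - klScale klE0 n)) k))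
        (fun k => ψ₁ k + (hubbardCutoffWeightCT L M β μ (klFlowFrameU L M β U μ (n + 1)) (klScale klE0 (n + 1)) k -
          hubbardCutoffWeightCT L M β μ (klFlowFrameU L M β U μ (n + 1)) (klScale klE0 n + t * (klScale klE0 (n + 1) - klScale klE0 n)) k)) Qm p : ℝ) : ℂ))
    (hb₁'def : b₁' = fun Qm t p => (((klScale klE0 (n + 1) - klScale klE0 n) *
        (klBubbleMass L M β μ (klFlowFrameU L M β U μ (n + 1))
            (fun k => deriv (fun Λ' => hubbardCutoffWeightCT L M β μ (klFlowFrameU L M β U μ (n + 1)) Λ' k) (klScale klE0 n + t * (klScale klE0 (n + 1) - klScale klE0 n)))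
            (fun k => ψ₁ k + (hubbardCutoffWeightCT L M β μ (klFlowFrameU L M β U μ (n + 1)) (klScale klE0 (n + 1)) k -
          hubbardCutoffWeightCT L M β μ (klFlowFrameU L M β U μ (n + 1)) (klScale klE0 n + t * (klScale klE0 (n + 1) - klScale klE0 n)) k)) Qm p +
          klBubbleMass L M β μ (klFlowFrameU L M β U μ (n + 1))
            (fun k => ψ₁ k + (hubbardCutoffWeightCT L M β μ (klFlowFrameU L M β U μ (n + 1)) (klScale klE0 (n + 1)) k -
          hubbardCutoffWeightCT L M β μ (klFlowFrameU L M β U μ (n + 1)) (klScale klE0 n + t * (klScale klE0 (n + 1) - klScale klE0 n)) k))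
            (fun k => deriv (fun Λ' => hubbardCutoffWeightCT L M β μ (klFlowFrameU L M β U μ (n + 1)) Λ' k) (klScale klE0 n + t * (klScale klE0 (n + 1) - klScale klE0 n)))
            Qm p) : ℝ) : ℂ))
    (hb₂def : b₂ = fun Qm t p => -((klBubbleMass L M β μ (klFlowFrameU L M β U μ (n + 1))
        (fun k => ψ₂ k + (hubbardCutoffWeightCT L M β μ (klFlowFrameU L M β U μ (n + 1)) (klScale klE0 (n + 1)) k -
          hubbardCutoffWeightCT L M β μ (klFlowFrameU L M β U μ (n + 1)) (klScale klE0 n + t * (klScale klE0 (n + 1) - klScale klE0 n)) k))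
        (fun k => ψ₂ k + (hubbardCutoffWeightCT L M β μ (klFlowFrameU L M β U μ (n + 1)) (klScale klE0 (n + 1)) k -
          hubbardCutoffWeightCT L M β μ (klFlowFrameU L M β U μ (n + 1)) (klScale klE0 n + t * (klScale klE0 (n + 1) - klScale klE0 n)) k)) Qm p : ℝ) : ℂ))
    (hb₂'def : b₂' = fun Qm t p => (((klScale klE0 (n + 1) - klScale klE0 n) *
        (klBubbleMass L M β μ (klFlowFrameU L M β U μ (n + 1))
            (fun k => deriv (fun Λ' => hubbardCutoffWeightCT L M β μ (klFlowFrameU L M β U μ (n + 1)) Λ' k) (klScale klE0 n + t * (klScale klE0 (n + 1) - klScale klE0 n)))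
            (fun k => ψ₂ k + (hubbardCutoffWeightCT L M β μ (klFlowFrameU L M β U μ (n + 1)) (klScale klE0 (n + 1)) k -
          hubbardCutoffWeightCT L M β μ (klFlowFrameU L M β U μ (n + 1)) (klScale klE0 n + t * (klScale klE0 (n + 1) - klScale klE0 n)) k)) Qm p +
          klBubbleMass L M β μ (klFlowFrameU L M β U μ (n + 1))
            (fun k => ψ₂ k + (hubbardCutoffWeightCT L M β μ (klFlowFrameU L M β U μ (n + 1)) (klScale klE0 (n + 1)) k -
          hubbardCutoffWeightCT L M β μ (klFlowFrameU L M β U μ (n + 1)) (klScale klE0 n + t * (klScale klE0 (n + 1) - klScale klE0 n)) k))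
            (fun k => deriv (fun Λ' => hubbardCutoffWeightCT L M β μ (klFlowFrameU L M β U μ (n + 1)) Λ' k) (klScale klE0 n + t * (klScale klE0 (n + 1) - klScale klE0 n)))
            Qm p) : ℝ) : ℂ))
    (hadef : a = fun Qm t p => (b₁ Qm t p - b₂ Qm t p) +
      (-(((klTransferWeight L M β μ (klFlowFrameU L M β U μ (n + 1)) (n + 1) ψ₁ Qm p - klTransferWeight L M β μ (klFlowFrameU L M β U μ (n + 1)) (n + 1) ψ₂ Qm p : ℝ)) : ℂ) -
        (b₁ Qm 1 p - b₂ Qm 1 p)))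
    (hdata : ∀ Qm : TorusSite 2 L, IsPairClassAt L Qm (n + 1) →
      ∃ (ρ₁ ρ₂ : TorusSite 2 L → ℝ) (ηr η₁ η₂ T₀ R₀ I S T : TorusSite 2 L → TorusSite 2 L → ℝ) (d : TorusSite 2 L → ℝ) (β' δ ξ ξ₁ ξ₂ : ℝ),
        0 ≤ δ ∧ 0 ≤ ξ ∧ 0 ≤ ξ₁ ∧ 0 ≤ ξ₂ ∧
        -- a priori sizes of the two member arrays, rates, profiles, smallness, Riccati-defect sups
        (∀ t ∈ Icc (0 : ℝ) 1, ∀ x y, ‖A₁ Qm t x y‖ ≤ m) ∧ (∀ t ∈ Icc (0 : ℝ) 1, ∀ x y, ‖A₂ Qm t x y‖ ≤ m) ∧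
        (∀ t ∈ Icc (0 : ℝ) 1, ∑ c, ‖b₁' Qm t c‖ ≤ β') ∧ (∀ t ∈ Icc (0 : ℝ) 1, ∑ c, ‖b₂' Qm t c‖ ≤ β') ∧
        (∀ t ∈ Icc (0 : ℝ) 1, ∀ c, ‖b₁ Qm t c - b₁ Qm 0 c‖ ≤ ρ₁ c) ∧ (∀ t ∈ Icc (0 : ℝ) 1, ∀ c, ‖b₂ Qm t c - b₂ Qm 0 c‖ ≤ ρ₂ c) ∧
        m * β' ≤ 1 / 3 ∧ m * ∑ c, ρ₁ c ≤ 1 / 3 ∧ m * ∑ c, ρ₂ c ≤ 1 / 3 ∧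
        (∀ t ∈ Icc (0 : ℝ) 1, ∀ x y, ‖(A₁' Qm t + A₁ Qm t * diagonal (b₁' Qm t) * A₁ Qm t) x y‖ ≤ ξ₁) ∧
        (∀ t ∈ Icc (0 : ℝ) 1, ∀ x y, ‖(A₂' Qm t + A₂ Qm t * diagonal (b₂' Qm t) * A₂ Qm t) x y‖ ≤ ξ₂) ∧
        -- the history arrays' a priori size and the START RE-FRAME majorants ((F)(i) lane) against the history objects at frame `K_n`
        (∀ x y, ‖klMemberArrayF L M β U μ n χ₁ Qm x y‖ ≤ m) ∧ (∀ x y, ‖klMemberArrayF L M β U μ n χ₂ Qm x y‖ ≤ m) ∧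
        (∀ x y, ‖((A₁ Qm 0 - klMemberArrayF L M β U μ n χ₁ Qm) - (A₂ Qm 0 - klMemberArrayF L M β U μ n χ₂ Qm)) x y‖ ≤ ηr x y) ∧
        (∀ x y, ‖(A₁ Qm 0 - klMemberArrayF L M β U μ n χ₁ Qm) x y‖ ≤ η₁ x y) ∧
        (∀ x y, ‖(A₂ Qm 0 - klMemberArrayF L M β U μ n χ₂ Qm) x y‖ ≤ η₂ x y) ∧
        (∀ c, ‖a Qm 0 c - -(((klTransferWeight L M β μ (klFlowFrameU L M β U μ n) n χ₁ Qm c -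
            klTransferWeight L M β μ (klFlowFrameU L M β U μ n) n χ₂ Qm c : ℝ)) : ℂ)‖ ≤ d c) ∧
        m * ∑ c, ‖a Qm 0 c‖ ≤ 1 / 3 ∧
        (∀ x y, ((if x ∈ klBall L μ 0 ∧ y ∈ klBall L μ 0 then Tb₀ Qm x y else 0) +
            ∑ c, (if x ∈ klBall L μ 0 ∧ c ∈ klBall L μ 0 then Tb₀ Qm x c else 0) *
              ‖(-(((klTransferWeight L M β μ (klFlowFrameU L M β U μ n) n χ₁ Qm c -
            klTransferWeight L M β μ (klFlowFrameU L M β U μ n) n χ₂ Qm c : ℝ)) : ℂ))‖ * m) +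
            ηr x y + m * ∑ c, η₁ x c * ‖a Qm 0 c‖ + m * m * ∑ c, d c +
            m * ∑ c, ‖(-(((klTransferWeight L M β μ (klFlowFrameU L M β U μ n) n χ₁ Qm c -
            klTransferWeight L M β μ (klFlowFrameU L M β U μ n) n χ₂ Qm c : ℝ)) : ℂ))‖ * η₂ c y ≤ T₀ x y) ∧
        (∀ x y, T₀ x y + ∑ c, T₀ x c * ‖a Qm 0 c‖ * (3 / 2 * m) ≤ R₀ x y) ∧
        (∀ x y, R₀ x y + ∑ c, R₀ x c * ‖a Qm 0 c‖ * m ≤ δ) ∧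
        -- the RELATIVE source (sup and slice integral), the intermediate majorants, endpoint smallness, the budget line
        (∀ t ∈ Icc (0 : ℝ) 1, ∀ x y, ‖((A₁' Qm t + A₁ Qm t * diagonal (b₁' Qm t) * A₁ Qm t) * (1 + diagonal (a Qm t) * A₂ Qm t) +
            A₁ Qm t * diagonal (a Qm t) * (A₂' Qm t + A₂ Qm t * diagonal (b₂' Qm t) * A₂ Qm t) - (A₂' Qm t + A₂ Qm t * diagonal (b₂' Qm t) * A₂ Qm t)) x y‖ ≤ ξ) ∧
        (∀ x y, (∫ t in (0 : ℝ)..1, ‖((A₁' Qm t + A₁ Qm t * diagonal (b₁' Qm t) * A₁ Qm t) * (1 + diagonal (a Qm t) * A₂ Qm t) +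
            A₁ Qm t * diagonal (a Qm t) * (A₂' Qm t + A₂ Qm t * diagonal (b₂' Qm t) * A₂ Qm t) - (A₂' Qm t + A₂ Qm t * diagonal (b₂' Qm t) * A₂ Qm t)) x y‖) ≤ I x y) ∧
        (∀ x y, (R₀ x y + ∑ c, R₀ x c * ‖a Qm 0 c‖ * m) +
            (I x y + ∑ c, I x c * ρ₂ c * m + ∑ a', m * ρ₁ a' * I a' y + ∑ a', ∑ c, m * ρ₁ a' * I a' c * ρ₂ c * m) +
            4 / 3 * (δ * Real.exp (m * β' + m * β') + 2 * ξ) * β' * (8 / 3 * ξ₁ + 8 / 3 * ξ₂) ≤ S x y) ∧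
        (∀ x y, S x y + ∑ c, S x c * ρ₂ c * (3 / 2 * m) + ∑ a', 3 / 2 * m * ρ₁ a' * S a' y +
            ∑ a', ∑ c, 3 / 2 * m * ρ₁ a' * S a' c * ρ₂ c * (3 / 2 * m) ≤ T x y) ∧
        m * ∑ c, ‖a Qm 1 c‖ ≤ 1 / 3 ∧
        (∀ k ∈ klBall L μ 0, ∀ k' ∈ klBall L μ 0, T k k' + ∑ c, T k c * ‖a Qm 1 c‖ * (3 / 2 * m) ≤ Tb Qm k k')) :
    PairTransferRelAt L M β U μ (n + 1) Tb ψ₁ ψ₂ := by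
  subst hA₁def hA₁'def hA₂def hA₂'def hb₁def hb₁'def hb₂def hb₂'def hadef
  refine pairTransferRelAt_succ L M hm (fun Qm hQm => ?_)
  obtain ⟨ρ₁, ρ₂, ηr, η₁, η₂, T₀, R₀, I, S, T, d, β', δ, ξ, ξ₁, ξ₂, hδ, hξ, hξ₁, hξ₂, hA₁m, hA₂m, hβ₁, hβ₂, hρ₁, hρ₂, hmβ, hZ₁, hZ₂,
    hS₁, hS₂, hH₁, hH₂, hηr, hη₁, hη₂, hd, hsm₀, hT₀, hR₀T, hR₀δ, hXξ, hI, hS, hT, hsm₁, hbud⟩ := hdata Qm hQm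
  -- the two members' flow data (calculus by name)
  obtain ⟨hdA₁, hcA₁, hA₁1, -⟩ := klmf_memberArray_flowData L M β U μ (klFlowFrameU L M β U μ (n + 1)) n ψ₁ Qm hZ _ _ rfl rfl
  obtain ⟨hdA₂, hcA₂, hA₂1, -⟩ := klmf_memberArray_flowData L M β U μ (klFlowFrameU L M β U μ (n + 1)) n ψ₂ Qm hZ _ _ rfl rfl
  obtain ⟨hdb₁, hcb₁, hb₁e⟩ := klmf_rung_data L M β μ (klFlowFrameU L M β U μ (n + 1)) n ψ₁ Qm _ _ rfl rfl
  obtain ⟨hdb₂, hcb₂, hb₂e⟩ := klmf_rung_data L M β μ (klFlowFrameU L M β U μ (n + 1)) n ψ₂ Qm _ _ rfl rfl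
  obtain ⟨hda, ha1, -⟩ := klmf_relWeight_data L M β μ (klFlowFrameU L M β U μ (n + 1)) n ψ₁ ψ₂ Qm _ _ _ _ _ hdb₁ hdb₂ hb₁e hb₂e rfl
  obtain ⟨hflow₁, hS₁c⟩ := klmf_riccati_of_defect _ _ _ _ hdA₁ hcA₁ hcb₁ rfl
  obtain ⟨hflow₂, hS₂c⟩ := klmf_riccati_of_defect _ _ _ _ hdA₂ hcA₂ hcb₂ rfl
  -- the start relation from the history clause across the frame shift
  obtain ⟨M₀, hM₀, -, hR⟩ := hhist.start_reframe (isPairClassAt_mono (L := L) hQm (Nat.le_succ n)) _ _ _ ηr η₁ η₂ T₀ d hm hH₁ hH₂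
    (hA₂m 0 ⟨le_rfl, zero_le_one⟩) hηr hη₁ hη₂ hd hsm₀ hT₀
  exact ⟨_, _, _, _, _, _, _, _, _, _, _, ρ₁, ρ₂, M₀, R₀, I, S, T, β', δ, ξ, ξ₁, ξ₂, hδ, hξ, hξ₁, hξ₂, hdA₁, hdA₂, hdb₁, hdb₂, hda, hcb₁, hcb₂,
    hS₁c, hS₂c, hflow₁, hflow₂, hA₁m, hA₂m, hβ₁, hβ₂, hρ₁, hρ₂, hmβ, hZ₁, hZ₂, hS₁, hS₂,
    hA₁1.trans (klmf_ballArray_succ_eq_klMemberArrayF L M β U μ n ψ₁ Qm), hA₂1.trans (klmf_ballArray_succ_eq_klMemberArrayF L M β U μ n ψ₂ Qm),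
    ha1, hM₀, fun x y => (hR x y).trans (hR₀T x y), hR₀δ, hXξ, hI, hS, hT, hsm₁, hbud⟩

end Keyed

/-! ## §2 The INDEX-family step (the body of Export5's `PairTransferRelFamilyK5 … n → … (n+1)`) and the budget target -/

section Family

variable (L M : ℕ) [NeZero L] [NeZero M]

set_option maxHeartbeats 1600000 in -- very long hypothesis bundle; plumbing into `pairTransferRelAt_succ_keyed`
/-- **`pairTransferRelIdx_family_succ`** — the relative family of the CUTOFF-BUILT pairs `(s_{n+1,j} | s_{n+1,j′})`, `n+1 ≤ j′ ≤ j ≤ n_β+1`, at the index-keyed bars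
`transferBarRelIdx … (n+1) j′`, from the family at scale `n` (bars `transferBarRelIdx … n j′`, pairs `n ≤ j′ ≤ j ≤ n_β+1`, frame `K_n`) and, per pair and pair class, the SIZES
bundle of `pairTransferRelAt_succ_keyed` on ONE family of member curves indexed by the member index (`A j`, `A′ j`, `b j`, `b′ j`; relative weight `a j j′`). -/
theorem pairTransferRelIdx_family_succ {G : GeoConsts} {P : SplitConsts} {r β U μ : ℝ} {n : ℕ} {mA : ℝ} (hm : 0 ≤ mA)
    (hZ : ∀ Λ ∈ Icc (klScale klE0 (n + 1)) (klScale klE0 n), hubbardEffPartitionFnCT L M β U μ 0 (klFlowFrameU L M β U μ (n + 1)) Λ ≠ 0)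
    (A A' : ℕ → TorusSite 2 L → ℝ → Matrix (TorusSite 2 L) (TorusSite 2 L) ℂ) (b b' : ℕ → TorusSite 2 L → ℝ → TorusSite 2 L → ℂ)
    (a : ℕ → ℕ → TorusSite 2 L → ℝ → TorusSite 2 L → ℂ)
    (hAdef : A = fun j Qm t => Matrix.of fun k k' : TorusSite 2 L => if k ∈ klBall L μ 0 ∧ k' ∈ klBall L μ 0 then
      vertexFn L M β (gaussConv ℂ
        (softCovOf L M β μ (klFlowFrameU L M β U μ (n + 1)) (softSymbolCompl L M β μ (klFlowFrameU L M β U μ (n + 1)) (n + 1) j) + hubbardCovAboveCT L M β μ 0 (klFlowFrameU L M β U μ (n + 1)) (klScale klE0 (n + 1)) -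
          hubbardCovAboveCT L M β μ 0 (klFlowFrameU L M β U μ (n + 1)) (klScale klE0 n + t * (klScale klE0 (n + 1) - klScale klE0 n)))
        (hubbardEffectiveActionCT L M β U μ 0 (klFlowFrameU L M β U μ (n + 1)) (klScale klE0 n + t * (klScale klE0 (n + 1) - klScale klE0 n)))) 4
        ![(((omega0 M, k'), 0), 0), ((((omega0 M).rev, Qm - k'), 1), 0), ((((omega0 M).rev, Qm - k), 1), 1), (((omega0 M, k), 0), 1)]
      else 0)
    (hA'def : A' = fun j Qm t => Matrix.of fun k k' : TorusSite 2 L => if k ∈ klBall L μ 0 ∧ k' ∈ klBall L μ 0 then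
      (klScale klE0 (n + 1) - klScale klE0 n) • -((2 : ℂ)⁻¹ * vertexFn L M β (gaussConv ℂ
        (softCovOf L M β μ (klFlowFrameU L M β U μ (n + 1)) (softSymbolCompl L M β μ (klFlowFrameU L M β U μ (n + 1)) (n + 1) j) + hubbardCovAboveCT L M β μ 0 (klFlowFrameU L M β U μ (n + 1)) (klScale klE0 (n + 1)) -
          hubbardCovAboveCT L M β μ 0 (klFlowFrameU L M β U μ (n + 1)) (klScale klE0 n + t * (klScale klE0 (n + 1) - klScale klE0 n)))
        (grassmannDerivPairing ℂ
          (Matrix.of fun X Y : HubbardFieldIdx L M => deriv (fun Λ'' : ℝ => hubbardCovAboveCT L M β μ 0 (klFlowFrameU L M β U μ (n + 1)) Λ'' X Y)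
            (klScale klE0 n + t * (klScale klE0 (n + 1) - klScale klE0 n)))
          (hubbardEffectiveActionCT L M β U μ 0 (klFlowFrameU L M β U μ (n + 1)) (klScale klE0 n + t * (klScale klE0 (n + 1) - klScale klE0 n)))
          (hubbardEffectiveActionCT L M β U μ 0 (klFlowFrameU L M β U μ (n + 1)) (klScale klE0 n + t * (klScale klE0 (n + 1) - klScale klE0 n))))) 4
        ![(((omega0 M, k'), 0), 0), ((((omega0 M).rev, Qm - k'), 1), 0), ((((omega0 M).rev, Qm - k), 1), 1), (((omega0 M, k), 0), 1)])
      else 0)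
    (hbdef : b = fun j Qm t p => -((klBubbleMass L M β μ (klFlowFrameU L M β U μ (n + 1))
        (fun k => (softSymbolCompl L M β μ (klFlowFrameU L M β U μ (n + 1)) (n + 1) j) k + (hubbardCutoffWeightCT L M β μ (klFlowFrameU L M β U μ (n + 1)) (klScale klE0 (n + 1)) k -
          hubbardCutoffWeightCT L M β μ (klFlowFrameU L M β U μ (n + 1)) (klScale klE0 n + t * (klScale klE0 (n + 1) - klScale klE0 n)) k))
        (fun k => (softSymbolCompl L M β μ (klFlowFrameU L M β U μ (n + 1)) (n + 1) j) k + (hubbardCutoffWeightCT L M β μ (klFlowFrameU L M β U μ (n + 1)) (klScale klE0 (n + 1)) k -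
          hubbardCutoffWeightCT L M β μ (klFlowFrameU L M β U μ (n + 1)) (klScale klE0 n + t * (klScale klE0 (n + 1) - klScale klE0 n)) k)) Qm p : ℝ) : ℂ))
    (hb'def : b' = fun j Qm t p => (((klScale klE0 (n + 1) - klScale klE0 n) *
        (klBubbleMass L M β μ (klFlowFrameU L M β U μ (n + 1))
            (fun k => deriv (fun Λ' => hubbardCutoffWeightCT L M β μ (klFlowFrameU L M β U μ (n + 1)) Λ' k) (klScale klE0 n + t * (klScale klE0 (n + 1) - klScale klE0 n)))
            (fun k => (softSymbolCompl L M β μ (klFlowFrameU L M β U μ (n + 1)) (n + 1) j) k + (hubbardCutoffWeightCT L M β μ (klFlowFrameU L M β U μ (n + 1)) (klScale klE0 (n + 1)) k -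
          hubbardCutoffWeightCT L M β μ (klFlowFrameU L M β U μ (n + 1)) (klScale klE0 n + t * (klScale klE0 (n + 1) - klScale klE0 n)) k)) Qm p +
          klBubbleMass L M β μ (klFlowFrameU L M β U μ (n + 1))
            (fun k => (softSymbolCompl L M β μ (klFlowFrameU L M β U μ (n + 1)) (n + 1) j) k + (hubbardCutoffWeightCT L M β μ (klFlowFrameU L M β U μ (n + 1)) (klScale klE0 (n + 1)) k -
          hubbardCutoffWeightCT L M β μ (klFlowFrameU L M β U μ (n + 1)) (klScale klE0 n + t * (klScale klE0 (n + 1) - klScale klE0 n)) k))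
            (fun k => deriv (fun Λ' => hubbardCutoffWeightCT L M β μ (klFlowFrameU L M β U μ (n + 1)) Λ' k) (klScale klE0 n + t * (klScale klE0 (n + 1) - klScale klE0 n)))
            Qm p) : ℝ) : ℂ))
    (hadef : a = fun j j' Qm t p => (b j Qm t p - b j' Qm t p) +
      (-(((klTransferWeight L M β μ (klFlowFrameU L M β U μ (n + 1)) (n + 1) (softSymbolCompl L M β μ (klFlowFrameU L M β U μ (n + 1)) (n + 1) j) Qm p -
          klTransferWeight L M β μ (klFlowFrameU L M β U μ (n + 1)) (n + 1) (softSymbolCompl L M β μ (klFlowFrameU L M β U μ (n + 1)) (n + 1) j') Qm p : ℝ)) : ℂ) -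
        (b j Qm 1 p - b j' Qm 1 p)))
    (hhist : ∀ j j' : ℕ, n ≤ j' → j' ≤ j → j ≤ nScales β + 1 →
      PairTransferRelAt L M β U μ n (transferBarRelIdx L G P r β U n j') (softSymbolCompl L M β μ (klFlowFrameU L M β U μ n) n j) (softSymbolCompl L M β μ (klFlowFrameU L M β U μ n) n j'))
    (hdata : ∀ j j' : ℕ, n + 1 ≤ j' → j' ≤ j → j ≤ nScales β + 1 → ∀ Qm : TorusSite 2 L, IsPairClassAt L Qm (n + 1) →
      ∃ (ρ₁ ρ₂ : TorusSite 2 L → ℝ) (ηr η₁ η₂ T₀ R₀ I S T : TorusSite 2 L → TorusSite 2 L → ℝ) (d : TorusSite 2 L → ℝ) (β' δ ξ ξ₁ ξ₂ : ℝ),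
        0 ≤ δ ∧ 0 ≤ ξ ∧ 0 ≤ ξ₁ ∧ 0 ≤ ξ₂ ∧
        -- a priori sizes of the two member arrays, rates, profiles, smallness, Riccati-defect sups
        (∀ t ∈ Icc (0 : ℝ) 1, ∀ x y, ‖A j Qm t x y‖ ≤ mA) ∧ (∀ t ∈ Icc (0 : ℝ) 1, ∀ x y, ‖A j' Qm t x y‖ ≤ mA) ∧
        (∀ t ∈ Icc (0 : ℝ) 1, ∑ c, ‖b' j Qm t c‖ ≤ β') ∧ (∀ t ∈ Icc (0 : ℝ) 1, ∑ c, ‖b' j' Qm t c‖ ≤ β') ∧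
        (∀ t ∈ Icc (0 : ℝ) 1, ∀ c, ‖b j Qm t c - b j Qm 0 c‖ ≤ ρ₁ c) ∧ (∀ t ∈ Icc (0 : ℝ) 1, ∀ c, ‖b j' Qm t c - b j' Qm 0 c‖ ≤ ρ₂ c) ∧
        mA * β' ≤ 1 / 3 ∧ mA * ∑ c, ρ₁ c ≤ 1 / 3 ∧ mA * ∑ c, ρ₂ c ≤ 1 / 3 ∧
        (∀ t ∈ Icc (0 : ℝ) 1, ∀ x y, ‖(A' j Qm t + A j Qm t * diagonal (b' j Qm t) * A j Qm t) x y‖ ≤ ξ₁) ∧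
        (∀ t ∈ Icc (0 : ℝ) 1, ∀ x y, ‖(A' j' Qm t + A j' Qm t * diagonal (b' j' Qm t) * A j' Qm t) x y‖ ≤ ξ₂) ∧
        -- the history arrays' a priori size and the START RE-FRAME majorants ((F)(i) lane) against the history objects at frame `K_n`
        (∀ x y, ‖klMemberArrayF L M β U μ n (softSymbolCompl L M β μ (klFlowFrameU L M β U μ n) n j) Qm x y‖ ≤ mA) ∧ (∀ x y, ‖klMemberArrayF L M β U μ n (softSymbolCompl L M β μ (klFlowFrameU L M β U μ n) n j') Qm x y‖ ≤ mA) ∧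
        (∀ x y, ‖((A j Qm 0 - klMemberArrayF L M β U μ n (softSymbolCompl L M β μ (klFlowFrameU L M β U μ n) n j) Qm) - (A j' Qm 0 - klMemberArrayF L M β U μ n (softSymbolCompl L M β μ (klFlowFrameU L M β U μ n) n j') Qm)) x y‖ ≤ ηr x y) ∧
        (∀ x y, ‖(A j Qm 0 - klMemberArrayF L M β U μ n (softSymbolCompl L M β μ (klFlowFrameU L M β U μ n) n j) Qm) x y‖ ≤ η₁ x y) ∧
        (∀ x y, ‖(A j' Qm 0 - klMemberArrayF L M β U μ n (softSymbolCompl L M β μ (klFlowFrameU L M β U μ n) n j') Qm) x y‖ ≤ η₂ x y) ∧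
        (∀ c, ‖a j j' Qm 0 c - -(((klTransferWeight L M β μ (klFlowFrameU L M β U μ n) n (softSymbolCompl L M β μ (klFlowFrameU L M β U μ n) n j) Qm c -
            klTransferWeight L M β μ (klFlowFrameU L M β U μ n) n (softSymbolCompl L M β μ (klFlowFrameU L M β U μ n) n j') Qm c : ℝ)) : ℂ)‖ ≤ d c) ∧
        mA * ∑ c, ‖a j j' Qm 0 c‖ ≤ 1 / 3 ∧
        (∀ x y, ((if x ∈ klBall L μ 0 ∧ y ∈ klBall L μ 0 then transferBarRelIdx L G P r β U n j' Qm x y else 0) +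
            ∑ c, (if x ∈ klBall L μ 0 ∧ c ∈ klBall L μ 0 then transferBarRelIdx L G P r β U n j' Qm x c else 0) *
              ‖(-(((klTransferWeight L M β μ (klFlowFrameU L M β U μ n) n (softSymbolCompl L M β μ (klFlowFrameU L M β U μ n) n j) Qm c -
            klTransferWeight L M β μ (klFlowFrameU L M β U μ n) n (softSymbolCompl L M β μ (klFlowFrameU L M β U μ n) n j') Qm c : ℝ)) : ℂ))‖ * mA) +
            ηr x y + mA * ∑ c, η₁ x c * ‖a j j' Qm 0 c‖ + mA * mA * ∑ c, d c +
            mA * ∑ c, ‖(-(((klTransferWeight L M β μ (klFlowFrameU L M β U μ n) n (softSymbolCompl L M β μ (klFlowFrameU L M β U μ n) n j) Qm c -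
            klTransferWeight L M β μ (klFlowFrameU L M β U μ n) n (softSymbolCompl L M β μ (klFlowFrameU L M β U μ n) n j') Qm c : ℝ)) : ℂ))‖ * η₂ c y ≤ T₀ x y) ∧
        (∀ x y, T₀ x y + ∑ c, T₀ x c * ‖a j j' Qm 0 c‖ * (3 / 2 * mA) ≤ R₀ x y) ∧
        (∀ x y, R₀ x y + ∑ c, R₀ x c * ‖a j j' Qm 0 c‖ * mA ≤ δ) ∧
        -- the RELATIVE source (sup and slice integral), the intermediate majorants, endpoint smallness, the budget line
        (∀ t ∈ Icc (0 : ℝ) 1, ∀ x y, ‖((A' j Qm t + A j Qm t * diagonal (b' j Qm t) * A j Qm t) * (1 + diagonal (a j j' Qm t) * A j' Qm t) +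
            A j Qm t * diagonal (a j j' Qm t) * (A' j' Qm t + A j' Qm t * diagonal (b' j' Qm t) * A j' Qm t) - (A' j' Qm t + A j' Qm t * diagonal (b' j' Qm t) * A j' Qm t)) x y‖ ≤ ξ) ∧
        (∀ x y, (∫ t in (0 : ℝ)..1, ‖((A' j Qm t + A j Qm t * diagonal (b' j Qm t) * A j Qm t) * (1 + diagonal (a j j' Qm t) * A j' Qm t) +
            A j Qm t * diagonal (a j j' Qm t) * (A' j' Qm t + A j' Qm t * diagonal (b' j' Qm t) * A j' Qm t) - (A' j' Qm t + A j' Qm t * diagonal (b' j' Qm t) * A j' Qm t)) x y‖) ≤ I x y) ∧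
        (∀ x y, (R₀ x y + ∑ c, R₀ x c * ‖a j j' Qm 0 c‖ * mA) +
            (I x y + ∑ c, I x c * ρ₂ c * mA + ∑ a', mA * ρ₁ a' * I a' y + ∑ a', ∑ c, mA * ρ₁ a' * I a' c * ρ₂ c * mA) +
            4 / 3 * (δ * Real.exp (mA * β' + mA * β') + 2 * ξ) * β' * (8 / 3 * ξ₁ + 8 / 3 * ξ₂) ≤ S x y) ∧
        (∀ x y, S x y + ∑ c, S x c * ρ₂ c * (3 / 2 * mA) + ∑ a', 3 / 2 * mA * ρ₁ a' * S a' y +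
            ∑ a', ∑ c, 3 / 2 * mA * ρ₁ a' * S a' c * ρ₂ c * (3 / 2 * mA) ≤ T x y) ∧
        mA * ∑ c, ‖a j j' Qm 1 c‖ ≤ 1 / 3 ∧
        (∀ k ∈ klBall L μ 0, ∀ k' ∈ klBall L μ 0, T k k' + ∑ c, T k c * ‖a j j' Qm 1 c‖ * (3 / 2 * mA) ≤ transferBarRelIdx L G P r β U (n + 1) j' Qm k k')) :
    ∀ j j' : ℕ, n + 1 ≤ j' → j' ≤ j → j ≤ nScales β + 1 →
      PairTransferRelAt L M β U μ (n + 1) (transferBarRelIdx L G P r β U (n + 1) j') (softSymbolCompl L M β μ (klFlowFrameU L M β U μ (n + 1)) (n + 1) j) (softSymbolCompl L M β μ (klFlowFrameU L M β U μ (n + 1)) (n + 1) j') := by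
  subst hAdef hA'def hbdef hb'def hadef
  intro j j' h1 h2 h3
  exact pairTransferRelAt_succ_keyed L M hm (hhist j j' ((Nat.le_succ n).trans h1) h2 h3) hZ _ _ _ _ _ _ _ _ _ rfl rfl rfl rfl rfl rfl rfl rfl rfl
    (hdata j j' h1 h2 h3)

omit [NeZero L] [NeZero M] in
variable {L M} in
/-- **The budget target of the index step** (names the inequality the closer proves): anything below the inherited bar inflated by the frame slack `1 + 2^{−(n+2)}` plus the
slice's ROOM at the prefactor `klIdxPrefactor r (n+1)` is below the new bar (`transferBarRelIdx_succ_room`, p590284; history pairs `n+1 ≤ j′`). -/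
theorem pairTransferRelIdx_budget_of_room {G : GeoConsts} (hCF : 0 ≤ G.CF) (P : SplitConsts) (hK : 0 ≤ P.Klam) {r : ℝ} (hr : 0 ≤ r) (β U : ℝ) {n j' : ℕ}
    (hn : n + 1 ≤ j') (Qm k k' : TorusSite 2 L) {X : ℝ}
    (h : X ≤ (1 + ((2 : ℝ) ^ (n + 2))⁻¹) * transferBarRelIdx L G P r β U n j' Qm k k' +
        klIdxPrefactor r (n + 1) * ((P.Klam * U) ^ 2 *
              ((min (klTorusNorm L (k - k') / klScale klE0 (n + 1)) (klScale klE0 (n + 1) / klTorusNorm L (k - k')) +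
                  min (klTorusNorm L (k + k' - Qm) / klScale klE0 (n + 1)) (klScale klE0 (n + 1) / klTorusNorm L (k + k' - Qm)) +
                  ((2 : ℝ) ^ n)⁻¹ + 3 * ((L : ℝ))⁻¹) * klIdxMass n j' + ((4 : ℝ) ^ (n + 1))⁻¹ * klIdxOverlap (n + 1) j') +
            ((P.Klam * |U|) ^ 3 * ((2 : ℝ) ^ n)⁻¹ + 3 * thermalBar G P U β (n + 1)) * klIdxMass n j')) :
    X ≤ transferBarRelIdx L G P r β U (n + 1) j' Qm k k' :=
  h.trans (transferBarRelIdx_succ_room hCF P hK hr β U hn Qm k k')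

end Family

end Summit.HubbardSuperconductivity.HubbardSuperconductivity.Theorems.KLRegimeSplit

end
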